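import Summits.BirchSwinnertonDyer.BirchSwinnertonDyer.Theorems.BiquadraticEisensteinDescentHeegnerTwistCouplingInSupplySymbolicMonskyEvenDesignMuOne
import HarnessLib

set_option linter.dupNamespace false -- `Summit.BirchSwinnertonDyer.BirchSwinnertonDyer.Theorems.…` (summit = sub)
set_option autoImplicit false

/-!
# Crux `HeegnerTwistCouplingInSupply` (stmt-BirchSwinnertonDyer-21381) — the even pencil at `δ = 0` against the pencil at `δ = 1`:
# plane sections (general lemmas for the exact-door theorem of `…EvenDesignNoSevenDoorIff`)

Route `BiquadraticEisensteinDescent` (cell `pub/bsd-wall`, width seat `bsd-wall-cm-bed-w3` g25; `--supports` 21381, helper). For an even base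
`E_{2·P₀⋯P_k}` with symbol datum `base`, `W_ev(δ) = T_δ(𝒦_ev) ⊕ ⟨(δ, 1+δ)⟩` is the even pencil of the reviewed def `SymbData.evenPencil`;
`W_ev(0) = {(v + ⟨m,u⟩·1, u + γ·1)}` and `W_ev(1) = {(v + γ·1, u)}` over the even kernel pairs `(u, v)` and `γ ∈ 𝔽₂`. This file compares their
three plane sections (used by `…EvenDesignNoSevenDoorIff`, w3 g25, to open the door with `δ = 0` exactly when `δ = 1` fails on the class family
`{1,3,5} (mod 8)`):
* `evenPencil_zero_legit` — `δ = 0` is legitimate (`(0,1) ∉ T_0(𝒦_ev)`) as soon as some base prime has `(2/P) = −1`;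
* `evenPencil_zero_inf_ker_snd_le` — with a prime `≡ 5 (mod 8)`: `W_ev(0) ∩ V×0 ⊆ {(v,0) : (0,v) ∈ 𝒦_ev}`, so `dim ≤ a₁ := dim (𝒦_ev ∩ 0×V)`;
* `finrank_evenPencil_zero_inf_ker_fst_le` — every base: `W_ev(0) ∩ 0×V ⊆ (W_ev(1) ∩ 0×V) + ⟨(0,1)⟩`, so `dim ≤ dim (W_ev(1) ∩ 0×V) + 1`;
* `finrank_evenPencil_zero_inf_diag_le` — every base with an odd number of primes `≡ 3 (mod 4)`: `dim (W_ev(0) ∩ Δ) ≤ dim (W_ev(1) ∩ Δ)`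
  (both sections are parametrised by the kernel pairs `(u, u + ε·1)`: the first is the image of `{(u,v) ∈ 𝒦_ev : u+v ∈ ⟨1⟩}` under
  `(u,v) ↦ (v + ⟨m,u⟩1, v + ⟨m,u⟩1)`, and `(u,v) ↦ (u,u)` embeds that space into the second).
HONEST FRAMING: RUNG-LEVEL corner layer; `𝔽₂`-linear algebra attached to Monsky matrices [cite: HeathBrown1994SelmerCongruentII, Appendix (Monsky),
typescript p. 41 L20–L36]; the crux as stated (C⁺), its registered stubs and BSD are NOT touched; nothing is closed. THEOREMS ONLY.
-/


namespace Summit.BirchSwinnertonDyer.BirchSwinnertonDyer.Theorems.SymbolicMonsky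

section ZeroSections

open Module Matrix Literature.NumberTheory.EllipticCurves Literature.NumberTheory.EllipticCurves.HeathBrown1994
  Literature.NumberTheory.EllipticCurves.HeathBrown1994.Families
open Literature.NumberTheory.EllipticCurves.Rank1Residual

variable {k : ℕ} (base : SymbData (k + 1))

/-- Elements of the even pencil at `δ = 1`: `(v + γ·1, u)` for an even kernel pair `(u, v)` and `γ ∈ 𝔽₂`. -/
private theorem mem_evenPencil_one_iff₆ (p : (Fin (k + 1) → ZMod 2) × (Fin (k + 1) → ZMod 2)) :
    p ∈ base.evenPencil (fun _ => 1) ↔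
      ∃ (u v : Fin (k + 1) → ZMod 2) (γ : ZMod 2), (u, v) ∈ base.evenVirtualKernel ∧ p = (fun b => v b + γ, u) := by
  have h11 : (1 : ZMod 2) + 1 = 0 := by decide
  rw [mem_evenPencil_iff]
  constructor
  · rintro ⟨u, v, γ, hE1, hE2, rfl⟩
    refine ⟨u, v, γ, (mem_evenVirtualKernel_iff base (u, v)).2 ⟨hE1, hE2⟩, Prod.ext ?_ ?_⟩
    · funext b; simp [h11]
    · funext b; simp [h11]
  · rintro ⟨u, v, γ, huv, rfl⟩
    obtain ⟨hE1, hE2⟩ := (mem_evenVirtualKernel_iff base (u, v)).1 huv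
    refine ⟨u, v, γ, hE1, hE2, Prod.ext ?_ ?_⟩
    · funext b; simp [h11]
    · funext b; simp [h11]

/-- Elements of the even pencil at `δ = 0`: `(v + ⟨m,u⟩·1, u + γ·1)` for an even kernel pair `(u, v)` and `γ ∈ 𝔽₂`. -/
private theorem mem_evenPencil_zero_iff (p : (Fin (k + 1) → ZMod 2) × (Fin (k + 1) → ZMod 2)) :
    p ∈ base.evenPencil (fun _ => 0) ↔
      ∃ (u v : Fin (k + 1) → ZMod 2) (γ : ZMod 2), (u, v) ∈ base.evenVirtualKernel ∧
        p = (fun b => v b + ∑ j, bz (negNegOne (base.cls j)) * u j, fun b => u b + γ) := by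
  rw [mem_evenPencil_iff]
  constructor
  · rintro ⟨u, v, γ, hE1, hE2, rfl⟩
    refine ⟨u, v, γ, (mem_evenVirtualKernel_iff base (u, v)).2 ⟨hE1, hE2⟩, Prod.ext ?_ ?_⟩
    · funext b; simp
    · funext b; simp
  · rintro ⟨u, v, γ, huv, rfl⟩
    obtain ⟨hE1, hE2⟩ := (mem_evenVirtualKernel_iff base (u, v)).1 huv
    refine ⟨u, v, γ, hE1, hE2, Prod.ext ?_ ?_⟩
    · funext b; simp
    · funext b; simp

/-- `δ = 0` is a legitimate design as soon as some base prime has `(2/P) = −1`: `(0, 1) ∉ T_0(𝒦_ev)` (else `(1, 1) ∈ 𝒦_ev`, whose first equation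
at that prime reads `1 = 0`). -/
theorem evenPencil_zero_legit (hμ : (∑ b, bz (negNegOne (base.cls b))) = 1) (b₅ : Fin (k + 1)) (hb₅ : negTwo (base.cls b₅) = true) :
    (((fun _ => (0 : ZMod 2)), fun i => 1 + (fun _ => (0 : ZMod 2)) i) : (Fin (k + 1) → ZMod 2) × (Fin (k + 1) → ZMod 2)) ∉
      base.evenVirtualKernel.map (base.evenTwist fun _ => 0) := by
  have h2 : ∀ x : ZMod 2, x + x = 0 := by decide
  intro h
  obtain ⟨q, hq, hTq⟩ := Submodule.mem_map.1 h
  rw [evenTwist_apply] at hTq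
  have hq1 : ∀ i, q.1 i = 1 := fun i => by
    have := congrFun (congrArg Prod.snd hTq) i
    simpa using this
  have hMq : (∑ j, bz (negNegOne (base.cls j)) * q.1 j) = 1 := by
    rw [Finset.sum_congr rfl fun j (_ : j ∈ Finset.univ) => by rw [hq1 j, mul_one], hμ]
  have hq2 : ∀ i, q.2 i = 1 := fun i => by
    have := congrFun (congrArg Prod.fst hTq) i
    simp only [hMq, add_zero, one_mul] at this
    linear_combination this - h2 1
  have e := ((mem_evenVirtualKernel_iff base q).1 hq).1 b₅
  simp only [hq1, hq2, h2, mul_zero, Finset.sum_const_zero, zero_add, mul_one, hb₅] at e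
  rw [hμ] at e
  have hd5 : bz true = 1 := rfl
  rw [hd5] at e
  have hm : bz (negNegOne (base.cls b₅)) + bz (negNegOne (base.cls b₅)) = 0 := h2 _
  have : (1 : ZMod 2) = 0 := by linear_combination e - hm
  exact one_ne_zero this

/-- **The `V × 0` section of `W_ev(0)`** when some base prime is `≡ 5 (mod 8)`: it consists of the `(v, 0)` with `(0, v) ∈ 𝒦_ev`
(an element `(v + ⟨m,u⟩1, u + γ1)` with second component `0` has `u = γ·1`, and the first kernel equation at the prime `≡ 5 (mod 8)` gives
`γ = 0`). Hence `dim (W_ev(0) ∩ V×0) ≤ dim (𝒦_ev ∩ 0×V) = a₁`. [cite: HeathBrown1994SelmerCongruentII, Appendix (Monsky), typescript p. 41 L20–L36] -/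
theorem evenPencil_zero_inf_ker_snd_le (b₅ : Fin (k + 1)) (hb₅ : negTwo (base.cls b₅) = true) (hb₅' : negNegOne (base.cls b₅) = false) :
    finrank (ZMod 2) ↥(base.evenPencil (fun _ => 0) ⊓
        LinearMap.ker (LinearMap.snd (ZMod 2) (Fin (k + 1) → ZMod 2) (Fin (k + 1) → ZMod 2))) ≤
      finrank (ZMod 2) ↥(base.evenVirtualKernel ⊓
        LinearMap.ker (LinearMap.fst (ZMod 2) (Fin (k + 1) → ZMod 2) (Fin (k + 1) → ZMod 2))) := by
  have h2 : ∀ x : ZMod 2, x + x = 0 := by decide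
  set e := LinearEquiv.prodComm (ZMod 2) (Fin (k + 1) → ZMod 2) (Fin (k + 1) → ZMod 2) with he
  have hle : base.evenPencil (fun _ => 0) ⊓ LinearMap.ker (LinearMap.snd (ZMod 2) (Fin (k + 1) → ZMod 2) (Fin (k + 1) → ZMod 2)) ≤
      (base.evenVirtualKernel ⊓ LinearMap.ker (LinearMap.fst (ZMod 2) (Fin (k + 1) → ZMod 2) (Fin (k + 1) → ZMod 2))).map
        e.toLinearMap := by
    intro p hp
    obtain ⟨hpW, hp0⟩ := Submodule.mem_inf.1 hp
    obtain ⟨u, v, γ, huv, rfl⟩ := (mem_evenPencil_zero_iff base p).1 hpW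
    rw [LinearMap.mem_ker, LinearMap.snd_apply] at hp0
    have hu : ∀ b, u b = γ := fun b => by
      have := congrFun hp0 b
      simp only [Pi.zero_apply] at this
      linear_combination this - h2 γ
    obtain ⟨hE1, -⟩ := (mem_evenVirtualKernel_iff base (u, v)).1 huv
    have hγ : γ = 0 := by
      have e := hE1 b₅
      simp only [hu, lap_const, zero_add, hb₅, hb₅'] at e
      have h0 : bz false = 0 := rfl
      have h1 : bz true = 1 := rfl
      rw [h0, h1] at e
      simpa using e
    have hu0 : u = 0 := funext fun b => by rw [hu b, hγ]; rfl
    have hMu : (∑ j, bz (negNegOne (base.cls j)) * u j) = 0 := by simp [hu0]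
    rw [hu0] at huv
    refine Submodule.mem_map.2 ⟨((0 : Fin (k + 1) → ZMod 2), v), Submodule.mem_inf.2 ⟨huv, by
      rw [LinearMap.mem_ker, LinearMap.fst_apply]⟩, ?_⟩
    rw [LinearEquiv.coe_toLinearMap, he, LinearEquiv.prodComm_apply, Prod.swap]
    refine Prod.ext (funext fun b => ?_) (funext fun b => ?_)
    · simp only [hMu, add_zero]
    · simp only [hu0, Pi.zero_apply, hγ, add_zero]
  calc finrank (ZMod 2) ↥(base.evenPencil (fun _ => 0) ⊓
          LinearMap.ker (LinearMap.snd (ZMod 2) (Fin (k + 1) → ZMod 2) (Fin (k + 1) → ZMod 2)))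
      ≤ finrank (ZMod 2) ↥((base.evenVirtualKernel ⊓
          LinearMap.ker (LinearMap.fst (ZMod 2) (Fin (k + 1) → ZMod 2) (Fin (k + 1) → ZMod 2))).map e.toLinearMap) :=
        Submodule.finrank_mono hle
    _ = _ := (LinearEquiv.finrank_eq (Submodule.equivMapOfInjective _ e.injective _)).symm

/-- **The `0 × V` section of `W_ev(0)` against that of `W_ev(1)`** (every base): `W_ev(0) ∩ 0×V ⊆ (W_ev(1) ∩ 0×V) + ⟨(0, 1)⟩` (an element
`(v + ⟨m,u⟩1, u + γ1)` with first component `0` has `v = ⟨m,u⟩·1`, and then `(0, u) = T_1(u, v) + ⟨m,u⟩·(1, 0) ∈ W_ev(1)`), so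
`dim (W_ev(0) ∩ 0×V) ≤ dim (W_ev(1) ∩ 0×V) + 1`. [cite: HeathBrown1994SelmerCongruentII, Appendix (Monsky), typescript p. 41 L20–L36] -/
theorem finrank_evenPencil_zero_inf_ker_fst_le :
    finrank (ZMod 2) ↥(base.evenPencil (fun _ => 0) ⊓
        LinearMap.ker (LinearMap.fst (ZMod 2) (Fin (k + 1) → ZMod 2) (Fin (k + 1) → ZMod 2))) ≤
      finrank (ZMod 2) ↥(base.evenPencil (fun _ => 1) ⊓
        LinearMap.ker (LinearMap.fst (ZMod 2) (Fin (k + 1) → ZMod 2) (Fin (k + 1) → ZMod 2))) + 1 := by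
  have h2 : ∀ x : ZMod 2, x + x = 0 := by decide
  set x₀ : (Fin (k + 1) → ZMod 2) × (Fin (k + 1) → ZMod 2) := (0, fun _ => 1) with hx₀
  have hle : base.evenPencil (fun _ => 0) ⊓ LinearMap.ker (LinearMap.fst (ZMod 2) (Fin (k + 1) → ZMod 2) (Fin (k + 1) → ZMod 2)) ≤
      (base.evenPencil (fun _ => 1) ⊓ LinearMap.ker (LinearMap.fst (ZMod 2) (Fin (k + 1) → ZMod 2) (Fin (k + 1) → ZMod 2))) ⊔
        Submodule.span (ZMod 2) {x₀} := by
    intro p hp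
    obtain ⟨hpW, hp0⟩ := Submodule.mem_inf.1 hp
    obtain ⟨u, v, γ, huv, rfl⟩ := (mem_evenPencil_zero_iff base p).1 hpW
    rw [LinearMap.mem_ker, LinearMap.fst_apply] at hp0
    set κ := ∑ j, bz (negNegOne (base.cls j)) * u j with hκ
    have hv : ∀ b, v b = κ := fun b => by
      have := congrFun hp0 b
      simp only [Pi.zero_apply] at this
      linear_combination this - h2 κ
    have h0u : (((0 : Fin (k + 1) → ZMod 2)), u) ∈ base.evenPencil (fun _ => 1) ⊓
        LinearMap.ker (LinearMap.fst (ZMod 2) (Fin (k + 1) → ZMod 2) (Fin (k + 1) → ZMod 2)) := by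
      refine Submodule.mem_inf.2 ⟨?_, by rw [LinearMap.mem_ker, LinearMap.fst_apply]⟩
      rw [mem_evenPencil_one_iff₆]
      exact ⟨u, v, κ, huv, Prod.ext (funext fun b => by simp only [Pi.zero_apply, hv, h2]) rfl⟩
    have hsum : ((fun b => v b + κ, fun b => u b + γ) : (Fin (k + 1) → ZMod 2) × (Fin (k + 1) → ZMod 2)) =
        (((0 : Fin (k + 1) → ZMod 2)), u) + γ • x₀ := by
      refine Prod.ext (funext fun b => ?_) (funext fun b => ?_)
      · simp [hx₀, hv, h2]
      · simp [hx₀]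
    rw [hsum]
    exact Submodule.add_mem_sup h0u (Submodule.smul_mem _ γ (Submodule.subset_span rfl))
  have hx₀0 : x₀ ≠ 0 := by
    intro h
    have := congrFun (congrArg Prod.snd h) 0
    simp [hx₀] at this
  have hx : finrank (ZMod 2) ↥(Submodule.span (ZMod 2) {x₀}) = 1 := finrank_span_singleton hx₀0
  calc finrank (ZMod 2) ↥(base.evenPencil (fun _ => 0) ⊓
          LinearMap.ker (LinearMap.fst (ZMod 2) (Fin (k + 1) → ZMod 2) (Fin (k + 1) → ZMod 2)))
      ≤ finrank (ZMod 2) ↥((base.evenPencil (fun _ => 1) ⊓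
          LinearMap.ker (LinearMap.fst (ZMod 2) (Fin (k + 1) → ZMod 2) (Fin (k + 1) → ZMod 2))) ⊔ Submodule.span (ZMod 2) {x₀}) :=
        Submodule.finrank_mono hle
    _ ≤ finrank (ZMod 2) ↥(base.evenPencil (fun _ => 1) ⊓
          LinearMap.ker (LinearMap.fst (ZMod 2) (Fin (k + 1) → ZMod 2) (Fin (k + 1) → ZMod 2))) +
          finrank (ZMod 2) ↥(Submodule.span (ZMod 2) {x₀}) := Submodule.finrank_add_le_finrank_add_finrank _ _
    _ ≤ _ := by omega

/-- **The diagonal section of `W_ev(0)` against that of `W_ev(1)`** (every base with an odd number of primes `≡ 3 (mod 4)`): both are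
parametrised by the kernel pairs `(u, u + ε·1)` (`ε ∈ 𝔽₂`) — `W_ev(0) ∩ Δ` is the image of `{(u,v) ∈ 𝒦_ev : u + v ∈ ⟨1⟩}` under
`(u,v) ↦ (v + ⟨m,u⟩1, v + ⟨m,u⟩1)`, and `(u,v) ↦ (u,u)` embeds the same space into `W_ev(1) ∩ Δ` — so
`dim (W_ev(0) ∩ Δ) ≤ dim (W_ev(1) ∩ Δ)`. [cite: HeathBrown1994SelmerCongruentII, Appendix (Monsky), typescript p. 41 L20–L36] -/
theorem finrank_evenPencil_zero_inf_diag_le (hμ : (∑ b, bz (negNegOne (base.cls b))) = 1) :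
    finrank (ZMod 2) ↥(base.evenPencil (fun _ => 0) ⊓
        LinearMap.ker (LinearMap.fst (ZMod 2) (Fin (k + 1) → ZMod 2) (Fin (k + 1) → ZMod 2) +
          LinearMap.snd (ZMod 2) (Fin (k + 1) → ZMod 2) (Fin (k + 1) → ZMod 2))) ≤
      finrank (ZMod 2) ↥(base.evenPencil (fun _ => 1) ⊓
        LinearMap.ker (LinearMap.fst (ZMod 2) (Fin (k + 1) → ZMod 2) (Fin (k + 1) → ZMod 2) +
          LinearMap.snd (ZMod 2) (Fin (k + 1) → ZMod 2) (Fin (k + 1) → ZMod 2))) := by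
  have h2 : ∀ x : ZMod 2, x + x = 0 := by decide
  -- the kernel pairs `(u, v)` with `u + v ∈ ⟨1⟩`
  set K₃ := base.evenVirtualKernel ⊓ Submodule.comap
    (LinearMap.fst (ZMod 2) (Fin (k + 1) → ZMod 2) (Fin (k + 1) → ZMod 2) +
      LinearMap.snd (ZMod 2) (Fin (k + 1) → ZMod 2) (Fin (k + 1) → ZMod 2))
    (Submodule.span (ZMod 2) {fun _ : Fin (k + 1) => (1 : ZMod 2)}) with hK₃
  -- the map `(u, v) ↦ (v + ⟨m,u⟩1, v + ⟨m,u⟩1)`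
  obtain ⟨φm, hφm⟩ := exists_dot_dual (k := k) (fun b => bz (negNegOne (base.cls b)))
  set ℓ : ((Fin (k + 1) → ZMod 2) × (Fin (k + 1) → ZMod 2)) →ₗ[ZMod 2] (Fin (k + 1) → ZMod 2) :=
    LinearMap.snd (ZMod 2) (Fin (k + 1) → ZMod 2) (Fin (k + 1) → ZMod 2) +
      (LinearMap.toSpanSingleton (ZMod 2) (Fin (k + 1) → ZMod 2) (fun _ => 1)).comp
        (φm.comp (LinearMap.fst (ZMod 2) (Fin (k + 1) → ZMod 2) (Fin (k + 1) → ZMod 2))) with hℓ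
  have hℓ_apply : ∀ q : (Fin (k + 1) → ZMod 2) × (Fin (k + 1) → ZMod 2),
      ℓ q = fun b => q.2 b + ∑ j, bz (negNegOne (base.cls j)) * q.1 j := fun q => by
    funext b
    simp only [hℓ, LinearMap.add_apply, LinearMap.snd_apply, LinearMap.comp_apply, LinearMap.fst_apply,
      LinearMap.toSpanSingleton_apply, hφm, Pi.add_apply, Pi.smul_apply, smul_eq_mul, mul_one]
  set Λ := ℓ.prod ℓ with hΛ
  -- (i) `W_ev(0) ∩ Δ ⊆ Λ(K₃)`
  have hle0 : base.evenPencil (fun _ => 0) ⊓ LinearMap.ker (LinearMap.fst (ZMod 2) (Fin (k + 1) → ZMod 2) (Fin (k + 1) → ZMod 2) +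
      LinearMap.snd (ZMod 2) (Fin (k + 1) → ZMod 2) (Fin (k + 1) → ZMod 2)) ≤ K₃.map Λ := by
    intro p hp
    obtain ⟨hpW, hp0⟩ := Submodule.mem_inf.1 hp
    obtain ⟨u, v, γ, huv, rfl⟩ := (mem_evenPencil_zero_iff base p).1 hpW
    rw [LinearMap.mem_ker, LinearMap.add_apply, LinearMap.fst_apply, LinearMap.snd_apply] at hp0
    set κ := ∑ j, bz (negNegOne (base.cls j)) * u j with hκ
    have hd : ∀ b, v b + κ = u b + γ := fun b => by
      have := congrFun hp0 b
      simp only [Pi.add_apply, Pi.zero_apply] at this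
      linear_combination this - h2 (u b + γ)
    have hK : ((u, v) : (Fin (k + 1) → ZMod 2) × (Fin (k + 1) → ZMod 2)) ∈ K₃ := by
      refine Submodule.mem_inf.2 ⟨huv, ?_⟩
      rw [Submodule.mem_comap, LinearMap.add_apply, LinearMap.fst_apply, LinearMap.snd_apply, Submodule.mem_span_singleton]
      refine ⟨κ + γ, funext fun b => ?_⟩
      simp only [Pi.smul_apply, Pi.add_apply, smul_eq_mul, mul_one]
      linear_combination hd b + h2 γ - h2 (v b)
    refine Submodule.mem_map.2 ⟨(u, v), hK, ?_⟩
    show (ℓ (u, v), ℓ (u, v)) = _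
    rw [hℓ_apply]
    exact Prod.ext rfl (funext fun b => hd b)
  -- (ii) `(u,v) ↦ (u,u)` embeds `K₃` into `W_ev(1) ∩ Δ`
  set Dg := (LinearMap.fst (ZMod 2) (Fin (k + 1) → ZMod 2) (Fin (k + 1) → ZMod 2)).prod
    (LinearMap.fst (ZMod 2) (Fin (k + 1) → ZMod 2) (Fin (k + 1) → ZMod 2)) with hDg
  have hle1 : K₃.map Dg ≤ base.evenPencil (fun _ => 1) ⊓ LinearMap.ker (LinearMap.fst (ZMod 2) (Fin (k + 1) → ZMod 2) (Fin (k + 1) → ZMod 2) +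
      LinearMap.snd (ZMod 2) (Fin (k + 1) → ZMod 2) (Fin (k + 1) → ZMod 2)) := by
    intro p hp
    obtain ⟨q, hq, rfl⟩ := Submodule.mem_map.1 hp
    obtain ⟨hqK, hq1⟩ := Submodule.mem_inf.1 hq
    rw [Submodule.mem_comap, LinearMap.add_apply, LinearMap.fst_apply, LinearMap.snd_apply, Submodule.mem_span_singleton] at hq1
    obtain ⟨a, ha⟩ := hq1
    have hqa : ∀ b, q.2 b + a = q.1 b := fun b => by
      have := congrFun ha b
      simp only [Pi.smul_apply, Pi.add_apply, smul_eq_mul, mul_one] at this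
      linear_combination this + h2 (q.2 b)
    have hDq : Dg q = (q.1, q.1) := rfl
    rw [hDq]
    refine Submodule.mem_inf.2 ⟨?_, ?_⟩
    · rw [mem_evenPencil_one_iff₆]
      exact ⟨q.1, q.2, a, (by simpa using hqK), Prod.ext (funext fun b => (hqa b).symm) rfl⟩
    · rw [LinearMap.mem_ker, LinearMap.add_apply, LinearMap.fst_apply, LinearMap.snd_apply]
      exact funext fun b => h2 _
  have hinj : Function.Injective (Dg.domRestrict K₃) := by
    rw [LinearMap.injective_domRestrict_iff, disjoint_iff, Submodule.eq_bot_iff]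
    intro q hq
    obtain ⟨hqK₃, hqD⟩ := Submodule.mem_inf.1 hq
    obtain ⟨hqK, hq1⟩ := Submodule.mem_inf.1 hqK₃
    have hq0 : q.1 = 0 := by
      have hDq : Dg q = (q.1, q.1) := rfl
      rw [LinearMap.mem_ker, hDq] at hqD
      exact congrArg Prod.fst hqD
    rw [Submodule.mem_comap, LinearMap.add_apply, LinearMap.fst_apply, LinearMap.snd_apply, Submodule.mem_span_singleton, hq0,
      zero_add] at hq1
    obtain ⟨a, ha⟩ := hq1
    -- `(0, a·1) ∈ 𝒦_ev` forces `a = 0` (first equation: `m_i a = 0`, and `Σ m_i = 1`)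
    obtain ⟨hE1, -⟩ := (mem_evenVirtualKernel_iff base q).1 hqK
    have ha0 : a = 0 := by
      have e : ∀ i, bz (negNegOne (base.cls i)) * a = 0 := fun i => by
        have := hE1 i
        rw [hq0, ← ha] at this
        simpa using this
      have hs : (∑ i, bz (negNegOne (base.cls i)) * a) = 0 := Finset.sum_eq_zero fun i _ => e i
      rw [← Finset.sum_mul, hμ, one_mul] at hs
      exact hs
    have hq2 : q.2 = 0 := by rw [← ha, ha0, zero_smul]
    exact Prod.ext hq0 hq2
  have hfin : finrank (ZMod 2) ↥(K₃.map Dg) = finrank (ZMod 2) ↥K₃ := by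
    rw [← LinearMap.range_domRestrict]
    exact LinearMap.finrank_range_of_inj hinj
  calc finrank (ZMod 2) ↥(base.evenPencil (fun _ => 0) ⊓ LinearMap.ker (LinearMap.fst (ZMod 2) (Fin (k + 1) → ZMod 2) (Fin (k + 1) → ZMod 2) +
          LinearMap.snd (ZMod 2) (Fin (k + 1) → ZMod 2) (Fin (k + 1) → ZMod 2)))
      ≤ finrank (ZMod 2) ↥(K₃.map Λ) := Submodule.finrank_mono hle0
    _ ≤ finrank (ZMod 2) ↥K₃ := Submodule.finrank_map_le _ _
    _ = finrank (ZMod 2) ↥(K₃.map Dg) := hfin.symm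
    _ ≤ _ := Submodule.finrank_mono hle1

end ZeroSections

end Summit.BirchSwinnertonDyer.BirchSwinnertonDyer.Theorems.SymbolicMonsky
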